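import Summits.CriticalPhenomena.PercolationContinuityZ3.Theorems.PercNearOneGluingNoHeavyLowerTailCILStarTransferTools
import Literature.Probability.LatticeModels.ProdBernoulliAtomExpansion
import Mathlib.Tactic.Ring
import HarnessLib

/-!
# `NoHeavyLowerTail` (stmt-CriticalPhenomena-4575), |A| = 5 glued rung — the THREE-PORT (one-layer) observer of `Z(3,2)`,
# part 1: the star expansion

Support file (prover seat `prim-ineq-gen-8`, gen 9; `--supports stmt-CriticalPhenomena-4575`).  No definitions, no named
facts, no sorries.  Memo: `run/shared/lean/prim/prim-ineq-gen-8/FINDING-gen9-THREEPORT.md`.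

SETTING (parts 1–3).  `μ = prodBernoulli w` on `Fin n`; an observer `o` and three targets `a, b, c` (distinct, `≠ o`); `o` is
a THREE-PORT (one-layer) observer: every pair `s(o,u)` with `u ∉ {a,b,c}` has weight `0`; the three HAIRS are
`α = w(o,a)`, `β = w(o,b)`, `γ = w(o,c)`; the graph off `o` is arbitrary.  Off `o` — for the configuration `ω ∩ {e | o ∉ e}` —
write `x ~' y` for reachability ("`H`-joined", as in `…CILStarTransferTools`).  This is the `K = {o}` case of the
cluster-of-`o` decomposition of the four-point row `Z(3,2)` = `OneCutFive.ZeroOneThree` (memo FINDING-gen8-Z32.md §6), in which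
the pocket law of `o` is LINEAR in the three-point law of `(a,b,c)` off `o` for fixed hairs.

THIS FILE (exact deletion–contraction over the three hairs = Kozma–Nitzan's star decomposition at `o`
[cite: KozmaNitzan2024, proof of Thm. 4 (pp. 13–14), "Summing over all B"]):
* `ThreePort.real_starEvent` (`_eight`) — `μ(σ_B) = (a∈B ? α : 1−α)(b∈B ? β : 1−β)(c∈B ? γ : 1−γ)` for `B ⊆ {a,b,c}`;
* `ThreePort.sum_powerset_three` — `Σ_{B ⊆ {a,b,c}}` written out;
* `ThreePort.real_setOf_eq_sum` — for ANY pattern `Φ` of the three connections,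
  `μ{Φ(o↔a, o↔b, o↔c)} = Σ_{B ⊆ {a,b,c}} μ(σ_B) · μ{Φ(B ~' a, B ~' b, B ~' c)}`;
  `real_setOf_eq_sum_all` — the same at an ARBITRARY observer, summing over all `B ⊆ V ∖ {o}` (appended, gen 9).
Part 2 (`…ThreePortCells`) is the dictionary of three-point cells off `o`; part 3 (`…ThreePort`) the exact formulas, the margin
identity, the heavy-hair theorem and the three-point row implied by `Z(3,2)`.
-/

noncomputable section

namespace Summit.CriticalPhenomena.PercolationContinuityZ3.Theorems

open MeasureTheory Set Literature.Probability.LatticeModels Literature.Probability.Percolation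
open scoped Classical BigOperators

variable {n : ℕ}

namespace ThreePort

open CutObserver KNPreFKG


/-! ### Star probabilities of a three-port vertex -/

/-- If every positive-weight pair at `o` ends in `a`, `b` or `c` (distinct, all `≠ o`), then for `B ⊆ {a,b,c}` the star
`σ_B` of `o` has probability `(a∈B ? α : 1−α)(b∈B ? β : 1−β)(c∈B ? γ : 1−γ)`.
[folklore; product measure, Grimmett 1999 §1.3] -/
theorem real_starEvent (w : Sym2 (Fin n) → unitInterval) (o a b c : Fin n) (hao : a ≠ o) (hbo : b ≠ o)
    (hco : c ≠ o) (hab : a ≠ b) (hac : a ≠ c) (hbc : b ≠ c)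
    (hobs : ∀ u, u ≠ o → u ≠ a → u ≠ b → u ≠ c → w s(o, u) = 0) (B : Finset (Fin n))
    (hB : B ⊆ {a, b, c}) :
    (prodBernoulli w).real (starEvent o (↑B : Set (Fin n))) =
      (if a ∈ B then (w s(o, a) : ℝ) else 1 - w s(o, a)) * (if b ∈ B then (w s(o, b) : ℝ) else 1 - w s(o, b)) *
        (if c ∈ B then (w s(o, c) : ℝ) else 1 - w s(o, c)) := by
  set μ := prodBernoulli w with hμ
  set F : Finset (Sym2 (Fin n)) := {s(o, a), s(o, b), s(o, c)} with hF
  set γ : Sym2 (Fin n) → Prop := fun e =>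
    (e = s(o, a) ∧ a ∈ B) ∨ (e = s(o, b) ∧ b ∈ B) ∨ (e = s(o, c) ∧ c ∈ B) with hγ
  set C : Set (BondConfig (Fin n)) := {ω | ∀ e ∈ F, (e ∈ ω ↔ γ e)} with hC
  set U : Finset (Fin n) := Finset.univ.filter fun u => u ≠ o ∧ u ≠ a ∧ u ≠ b ∧ u ≠ c with hU
  set N : Set (BondConfig (Fin n)) := {ω | ∃ u ∈ U, s(o, u) ∈ ω} with hN
  have hneab : s(o, a) ≠ s(o, b) := fun h => hab (Sym2.congr_right.1 h)
  have hneac : s(o, a) ≠ s(o, c) := fun h => hac (Sym2.congr_right.1 h)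
  have hnebc : s(o, b) ≠ s(o, c) := fun h => hbc (Sym2.congr_right.1 h)
  have hγa : γ s(o, a) ↔ a ∈ B := by
    constructor
    · rintro (⟨-, h⟩ | ⟨h, -⟩ | ⟨h, -⟩)
      · exact h
      · exact absurd h hneab
      · exact absurd h hneac
    · exact fun h => Or.inl ⟨rfl, h⟩
  have hγb : γ s(o, b) ↔ b ∈ B := by
    constructor
    · rintro (⟨h, -⟩ | ⟨-, h⟩ | ⟨h, -⟩)
      · exact absurd h.symm hneab
      · exact h
      · exact absurd h hnebc
    · exact fun h => Or.inr (Or.inl ⟨rfl, h⟩)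
  have hγc : γ s(o, c) ↔ c ∈ B := by
    constructor
    · rintro (⟨h, -⟩ | ⟨h, -⟩ | ⟨-, h⟩)
      · exact absurd h.symm hneac
      · exact absurd h.symm hnebc
      · exact h
    · exact fun h => Or.inr (Or.inr ⟨rfl, h⟩)
  -- the star is the cylinder `C` off the null event `N`
  have hσ : starEvent o (↑B : Set (Fin n)) = C \ N := by
    ext ω
    simp only [mem_starEvent_iff, Finset.mem_coe, hC, hN, mem_sdiff, mem_setOf_eq, not_exists, not_and, hF,
      Finset.mem_insert, Finset.mem_singleton]
    constructor
    · intro h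
      refine ⟨?_, fun u hu => ?_⟩
      · intro e he
        rcases he with rfl | rfl | rfl
        · rw [hγa]; exact h a hao
        · rw [hγb]; exact h b hbo
        · rw [hγc]; exact h c hco
      · rw [hU, Finset.mem_filter] at hu
        intro hopen
        have := (h u hu.2.1).1 hopen
        rcases Finset.mem_insert.1 (hB this) with h' | h'
        · exact hu.2.2.1 h'
        · rcases Finset.mem_insert.1 h' with h'' | h''
          · exact hu.2.2.2.1 h''
          · exact hu.2.2.2.2 (Finset.mem_singleton.1 h'')
    · rintro ⟨hCω, hNω⟩ u huo
      by_cases hua : u = a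
      · subst hua; rw [← hγa]; exact hCω _ (Or.inl rfl)
      by_cases hub : u = b
      · subst hub; rw [← hγb]; exact hCω _ (Or.inr (Or.inl rfl))
      by_cases huc : u = c
      · subst huc; rw [← hγc]; exact hCω _ (Or.inr (Or.inr rfl))
      have huU : u ∈ U := Finset.mem_filter.2 ⟨Finset.mem_univ _, huo, hua, hub, huc⟩
      constructor
      · intro h; exact absurd h (hNω u huU)
      · intro h
        rcases Finset.mem_insert.1 (hB h) with h' | h'
        · exact absurd h' hua
        · rcases Finset.mem_insert.1 h' with h'' | h''
          · exact absurd h'' hub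
          · exact absurd (Finset.mem_singleton.1 h'') huc
  have hN0 : μ.real N = 0 := by
    refine le_antisymm ?_ measureReal_nonneg
    have hNU : N = ⋃ u ∈ U, {ω : BondConfig (Fin n) | s(o, u) ∈ ω} := by
      ext ω; simp [hN]
    rw [hNU]
    refine (measureReal_biUnion_finset_le _ _).trans (Finset.sum_eq_zero fun u hu => ?_).le
    rw [hU, Finset.mem_filter] at hu
    rw [hμ, prodBernoulli_real_setOf_mem, hobs u hu.2.1 hu.2.2.1 hu.2.2.2.1 hu.2.2.2.2]
    rfl
  have hCval : μ.real C = (if a ∈ B then (w s(o, a) : ℝ) else 1 - w s(o, a)) *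
      (if b ∈ B then (w s(o, b) : ℝ) else 1 - w s(o, b)) * (if c ∈ B then (w s(o, c) : ℝ) else 1 - w s(o, c)) := by
    have hnot1 : s(o, a) ∉ ({s(o, b), s(o, c)} : Finset (Sym2 (Fin n))) := by
      simp [hneab, hneac]
    rw [hC, hμ, prodBernoulli_real_setOf_forall_iff, hF, Finset.prod_insert hnot1, Finset.prod_pair hnebc]
    simp only [hγa, hγb, hγc]
    ring
  have hdiff : μ.real (C \ N) = μ.real C := by
    have h1 : μ.real (C \ N) ≤ μ.real C := measureReal_mono sdiff_subset (measure_ne_top _ _)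
    have h2 : μ.real C ≤ μ.real (C \ N) + μ.real N := by
      calc μ.real C ≤ μ.real (C \ N ∪ N) := measureReal_mono (fun ω hω => by
              by_cases h : ω ∈ N
              · exact Or.inr h
              · exact Or.inl ⟨hω, h⟩) (measure_ne_top _ _)
        _ ≤ μ.real (C \ N) + μ.real N := measureReal_union_le _ _
    rw [hN0, add_zero] at h2
    exact le_antisymm h1 h2
  rw [hσ, hdiff, hCval]

/-- `Σ_{B ⊆ {a,b,c}} F(B)` written out, for distinct `a, b, c`. [folklore] -/
theorem sum_powerset_three {M : Type*} [AddCommMonoid M] (a b c : Fin n) (hab : a ≠ b) (hac : a ≠ c)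
    (hbc : b ≠ c) (F : Finset (Fin n) → M) :
    ∑ B ∈ ({a, b, c} : Finset (Fin n)).powerset, F B =
      F ∅ + F {a} + F {b} + F {c} + F {a, b} + F {a, c} + F {b, c} + F {a, b, c} := by
  have ha : a ∉ ({b, c} : Finset (Fin n)) := by simp [hab, hac]
  have hb : b ∉ ({c} : Finset (Fin n)) := by simp [hbc]
  have hc : ({c} : Finset (Fin n)) = insert c ∅ := rfl
  rw [Finset.sum_powerset_insert ha, Finset.sum_powerset_insert hb, Finset.sum_powerset_insert hb]
  rw [hc]
  rw [Finset.sum_powerset_insert (Finset.notMem_empty c), Finset.sum_powerset_insert (Finset.notMem_empty c),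
    Finset.sum_powerset_insert (Finset.notMem_empty c), Finset.sum_powerset_insert (Finset.notMem_empty c),
    Finset.powerset_empty]
  simp only [Finset.sum_singleton, Finset.insert_empty]
  abel


/-! ### The star expansion of a connection pattern -/

/-- **Star expansion at a three-port vertex.**  For ANY pattern `Φ` of the three connections `o↔a, o↔b, o↔c`:
`μ{Φ(o↔a, o↔b, o↔c)} = Σ_{B ⊆ {a,b,c}} μ(σ_B) · μ{Φ(B ~' a, B ~' b, B ~' c)}`, where `B ~' x` means that some vertex of
`B` is joined to `x` by an open path using no edge at `o`.  (The stars of `o` partition the space off a null set,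
`KNPreFKG.real_eq_sum_inter_starEvent`; on `σ_B`, `o ↔ x` iff `B ~' x` (`CutObserver.exists_avoid_of_reachable_star`,
`reachable_of_mem_star`); the star is independent of the configuration off `o`, `CutObserver.measureReal_starEvent_inter_avoid`.)
[cite: KozmaNitzan2024, proof of Thm. 4 (pp. 13–14)] -/
theorem real_setOf_eq_sum (w : Sym2 (Fin n) → unitInterval) (o a b c : Fin n) (hao : a ≠ o) (hbo : b ≠ o)
    (hco : c ≠ o) (hobs : ∀ u, u ≠ o → u ≠ a → u ≠ b → u ≠ c → w s(o, u) = 0)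
    (Φ : Prop → Prop → Prop → Prop) :
    (prodBernoulli w).real {ω | Φ (ω ∈ openConn o a) (ω ∈ openConn o b) (ω ∈ openConn o c)} =
      ∑ B ∈ ({a, b, c} : Finset (Fin n)).powerset, (prodBernoulli w).real (starEvent o (↑B : Set (Fin n))) *
        (prodBernoulli w).real {ω | Φ (∃ y ∈ B, (openGraph (ω ∩ {e | o ∉ e})).Reachable y a)
          (∃ y ∈ B, (openGraph (ω ∩ {e | o ∉ e})).Reachable y b)
          (∃ y ∈ B, (openGraph (ω ∩ {e | o ∉ e})).Reachable y c)} := by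
  have hoA : o ∉ ({a, b, c} : Finset (Fin n)) := by simp [hao.symm, hbo.symm, hco.symm]
  have hiso : ∀ u, u ≠ o → u ∉ ({a, b, c} : Finset (Fin n)) → w s(o, u) = 0 := by
    intro u huo hu
    simp only [Finset.mem_insert, Finset.mem_singleton, not_or] at hu
    exact hobs u huo hu.1 hu.2.1 hu.2.2
  rw [real_eq_sum_inter_starEvent w {a, b, c} o hoA hiso]
  refine Finset.sum_congr rfl fun B hB => ?_
  have hBsub : B ⊆ {a, b, c} := Finset.mem_powerset.1 hB
  have hBo : ∀ y ∈ B, y ≠ o := fun y hy h => hoA (h ▸ hBsub hy)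
  -- on the star `σ_B`: `o ↔ x` iff some `y ∈ B` is `H`-joined to `x`
  have key : ∀ x, x ≠ o → ∀ ω ∈ starEvent o (↑B : Set (Fin n)),
      (ω ∈ openConn o x ↔ ∃ y ∈ B, (openGraph (ω ∩ {e | o ∉ e})).Reachable y x) := by
    intro x hxo ω hσ
    constructor
    · intro h
      obtain ⟨y, hy, hyx⟩ := exists_avoid_of_reachable_star hσ hxo h
      exact ⟨y, Finset.mem_coe.1 hy, hyx⟩
    · rintro ⟨y, hy, hyx⟩
      exact reachable_of_mem_star hσ (hBo y hy) (Finset.mem_coe.2 hy) hyx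
  have hset : {ω | Φ (ω ∈ openConn o a) (ω ∈ openConn o b) (ω ∈ openConn o c)} ∩ starEvent o (↑B : Set (Fin n)) =
      starEvent o (↑B : Set (Fin n)) ∩ {ω | (fun ξ : BondConfig (Fin n) =>
        Φ (∃ y ∈ B, (openGraph ξ).Reachable y a) (∃ y ∈ B, (openGraph ξ).Reachable y b)
          (∃ y ∈ B, (openGraph ξ).Reachable y c)) (ω ∩ {e | o ∉ e})} := by
    ext ω
    simp only [mem_inter_iff, mem_setOf_eq]
    constructor
    · rintro ⟨hΦ, hσ⟩
      refine ⟨hσ, ?_⟩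
      rw [← propext (key a hao ω hσ), ← propext (key b hbo ω hσ), ← propext (key c hco ω hσ)]
      exact hΦ
    · rintro ⟨hσ, hΦ⟩
      refine ⟨?_, hσ⟩
      rw [propext (key a hao ω hσ), propext (key b hbo ω hσ), propext (key c hco ω hσ)]
      exact hΦ
  rw [hset]
  exact measureReal_starEvent_inter_avoid w o _ (fun ξ : BondConfig (Fin n) =>
    Φ (∃ y ∈ B, (openGraph ξ).Reachable y a) (∃ y ∈ B, (openGraph ξ).Reachable y b)
      (∃ y ∈ B, (openGraph ξ).Reachable y c))

/-- **Star expansion at an ARBITRARY observer** (the "random attachment set" form of the pocket law): for any `o`, any targets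
`a, b, c ≠ o` and any pattern `Φ`,
`μ{Φ(o↔a, o↔b, o↔c)} = Σ_{B ⊆ V∖{o}} μ(σ_B) · μ{Φ(B ~' a, B ~' b, B ~' c)}`, the sum running over ALL vertex sets `B ∌ o`
(`σ_B` = the open pairs at `o` are exactly those to `B`; `B ~' x` = some vertex of `B` is joined to `x` off `o`).  So the law of
`(1{o↔a}, 1{o↔b}, 1{o↔c})` is the mixture, over the independent random set `B` of vertices `o` attaches to, of the laws of
`(1{B~a}, 1{B~b}, 1{B~c})` in the graph `G − o`; `real_setOf_eq_sum` is the three-port case, where only `B ⊆ {a,b,c}` carry mass.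
[cite: KozmaNitzan2024, proof of Thm. 4 (pp. 13–14), "Summing over all B"] -/
theorem real_setOf_eq_sum_all (w : Sym2 (Fin n) → unitInterval) (o a b c : Fin n) (hao : a ≠ o) (hbo : b ≠ o)
    (hco : c ≠ o) (Φ : Prop → Prop → Prop → Prop) :
    (prodBernoulli w).real {ω | Φ (ω ∈ openConn o a) (ω ∈ openConn o b) (ω ∈ openConn o c)} =
      ∑ B ∈ (Finset.univ.erase o).powerset, (prodBernoulli w).real (starEvent o (↑B : Set (Fin n))) *
        (prodBernoulli w).real {ω | Φ (∃ y ∈ B, (openGraph (ω ∩ {e | o ∉ e})).Reachable y a)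
          (∃ y ∈ B, (openGraph (ω ∩ {e | o ∉ e})).Reachable y b)
          (∃ y ∈ B, (openGraph (ω ∩ {e | o ∉ e})).Reachable y c)} := by
  have hoA : o ∉ (Finset.univ.erase o : Finset (Fin n)) := Finset.notMem_erase o _
  have hiso : ∀ u, u ≠ o → u ∉ (Finset.univ.erase o : Finset (Fin n)) → w s(o, u) = 0 := by
    intro u huo hu
    exact absurd (Finset.mem_erase.2 ⟨huo, Finset.mem_univ u⟩) hu
  rw [real_eq_sum_inter_starEvent w (Finset.univ.erase o) o hoA hiso]
  refine Finset.sum_congr rfl fun B hB => ?_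
  have hBsub : B ⊆ Finset.univ.erase o := Finset.mem_powerset.1 hB
  have hBo : ∀ y ∈ B, y ≠ o := fun y hy => (Finset.mem_erase.1 (hBsub hy)).1
  have key : ∀ x, x ≠ o → ∀ ω ∈ starEvent o (↑B : Set (Fin n)),
      (ω ∈ openConn o x ↔ ∃ y ∈ B, (openGraph (ω ∩ {e | o ∉ e})).Reachable y x) := by
    intro x hxo ω hσ
    constructor
    · intro h
      obtain ⟨y, hy, hyx⟩ := exists_avoid_of_reachable_star hσ hxo h
      exact ⟨y, Finset.mem_coe.1 hy, hyx⟩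
    · rintro ⟨y, hy, hyx⟩
      exact reachable_of_mem_star hσ (hBo y hy) (Finset.mem_coe.2 hy) hyx
  have hset : {ω | Φ (ω ∈ openConn o a) (ω ∈ openConn o b) (ω ∈ openConn o c)} ∩ starEvent o (↑B : Set (Fin n)) =
      starEvent o (↑B : Set (Fin n)) ∩ {ω | (fun ξ : BondConfig (Fin n) =>
        Φ (∃ y ∈ B, (openGraph ξ).Reachable y a) (∃ y ∈ B, (openGraph ξ).Reachable y b)
          (∃ y ∈ B, (openGraph ξ).Reachable y c)) (ω ∩ {e | o ∉ e})} := by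
    ext ω
    simp only [mem_inter_iff, mem_setOf_eq]
    constructor
    · rintro ⟨hΦ, hσ⟩
      refine ⟨hσ, ?_⟩
      rw [← propext (key a hao ω hσ), ← propext (key b hbo ω hσ), ← propext (key c hco ω hσ)]
      exact hΦ
    · rintro ⟨hσ, hΦ⟩
      refine ⟨?_, hσ⟩
      rw [propext (key a hao ω hσ), propext (key b hbo ω hσ), propext (key c hco ω hσ)]
      exact hΦ
  rw [hset]
  exact measureReal_starEvent_inter_avoid w o _ (fun ξ : BondConfig (Fin n) =>
    Φ (∃ y ∈ B, (openGraph ξ).Reachable y a) (∃ y ∈ B, (openGraph ξ).Reachable y b)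
      (∃ y ∈ B, (openGraph ξ).Reachable y c))

section Eight

variable (w : Sym2 (Fin n) → unitInterval) (o a b c : Fin n) (hao : a ≠ o) (hbo : b ≠ o) (hco : c ≠ o)
  (hab : a ≠ b) (hac : a ≠ c) (hbc : b ≠ c) (hobs : ∀ u, u ≠ o → u ≠ a → u ≠ b → u ≠ c → w s(o, u) = 0)
include hao hbo hco hab hac hbc hobs

/-- The eight star weights of a three-port vertex, written out. [folklore] -/
theorem real_starEvent_eight :
    (prodBernoulli w).real (starEvent o (↑(∅ : Finset (Fin n)) : Set (Fin n))) =
        (1 - w s(o, a)) * (1 - w s(o, b)) * (1 - w s(o, c)) ∧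
      (prodBernoulli w).real (starEvent o (↑({a} : Finset (Fin n)) : Set (Fin n))) =
        w s(o, a) * (1 - w s(o, b)) * (1 - w s(o, c)) ∧
      (prodBernoulli w).real (starEvent o (↑({b} : Finset (Fin n)) : Set (Fin n))) =
        (1 - w s(o, a)) * w s(o, b) * (1 - w s(o, c)) ∧
      (prodBernoulli w).real (starEvent o (↑({c} : Finset (Fin n)) : Set (Fin n))) =
        (1 - w s(o, a)) * (1 - w s(o, b)) * w s(o, c) ∧
      (prodBernoulli w).real (starEvent o (↑({a, b} : Finset (Fin n)) : Set (Fin n))) =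
        w s(o, a) * w s(o, b) * (1 - w s(o, c)) ∧
      (prodBernoulli w).real (starEvent o (↑({a, c} : Finset (Fin n)) : Set (Fin n))) =
        w s(o, a) * (1 - w s(o, b)) * w s(o, c) ∧
      (prodBernoulli w).real (starEvent o (↑({b, c} : Finset (Fin n)) : Set (Fin n))) =
        (1 - w s(o, a)) * w s(o, b) * w s(o, c) ∧
      (prodBernoulli w).real (starEvent o (↑({a, b, c} : Finset (Fin n)) : Set (Fin n))) =
        w s(o, a) * w s(o, b) * w s(o, c) := by
  have H := real_starEvent w o a b c hao hbo hco hab hac hbc hobs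
  refine ⟨?_, ?_, ?_, ?_, ?_, ?_, ?_, ?_⟩
  · rw [H ∅ (Finset.empty_subset _)]; simp
  · rw [H {a} (by simp)]; simp [hab.symm, hac.symm]
  · rw [H {b} (by simp)]; simp [hab, hbc.symm]
  · rw [H {c} (by simp)]; simp [hac, hbc]
  · rw [H {a, b} (by simp [Finset.subset_iff])]; simp [hac.symm, hbc.symm]
  · rw [H {a, c} (by simp [Finset.subset_iff])]; simp [hab.symm, hbc]
  · rw [H {b, c} (by simp [Finset.subset_iff])]; simp [hab, hac]
  · rw [H {a, b, c} (subset_refl _)]; simp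

end Eight

end ThreePort

end Summit.CriticalPhenomena.PercolationContinuityZ3.Theorems

end
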